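import Summits.QuantumFields.YangMills.Theorems.BalabanUVNodesN15KingModelPotentialUnitSizeOnly

/-!
# N15 (NE2⁺), King-model rung, part 22b: the unit-layer failure BY NAME — `¬ NE2PlusUnit` on the size-only SORT

Cell `pub-ymgap-dag-n15-d` (R134 acceleration DAG, node N15 = NE2, strategy s3 KING-MODEL RUNG), part 22b.  Part 22 (`…PotentialUnitSizeOnly`) proved that
the definiens of `T4EtaRate.NE2PlusUnit c₃₅ (kingInstanceV L s) (kingKerVW L a m² s) ⊤ tdistT` with its `Reg336` hypothesis deleted is false.  THIS FILE says
the same BY NAME: on the sort `potBgSize` whose (3.35) slot is SIZE and whose (3.36) slot is VACUOUS (`True`), with the same geometries, pairing and dressed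
unit kernel as parts 8c ∕ 10d, `NE2PlusUnit` FAILS — so the predicate's (3.36) slot is doing work in part 10d's positive `ne2PlusUnit_kingVW`.

* §1 the sort `potBgSize`, the pairing `kingPairingSize`, the family `kingInstanceSize`, the kernel `kingKerSize` (part 10d's `kingKerVW`, verbatim), the
  unit distance `kingDistSize`; the window is populated by site-dependent towers (`potBgSize_reg_blockLift`);
* §2 ★★ `not_ne2PlusUnit_kingSize : ¬ NE2PlusUnit c₃₅ (kingInstanceSize L) (kingKerSize L a m²) ⊤ tdistT` (`L ≥ 2`, `a, m² > 0`, every `c₃₅ > 0`) —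
  part 22's `ne2PlusUnit_false_without_coherence` read through the (definitionally equal) configurations, size slot and kernel.

HONEST SCOPE.  King's A = 0 scalar model on the King-admissible tori, `L ≥ 2`, `a, m² > 0`; scalar potentials (NOT gauge fields); a NEGATIVE statement
about THIS LINEAGE's family∕sort, not about a printed proposition and not about Bałaban's `C^{(k)}(Λ;U)`; count-neutral (`--supports`), not a discharge of
N15; standard axioms.

References: [B9] = Bałaban, Commun. Math. Phys. 102 (1985) 385–462, (3.35)–(3.36) p.396, Thm 3.15 (3.187) p.432 (quantifier template) (bib key
`Balaban1985BackgroundPropagators`); C. King, Commun. Math. Phys. 102 (1986) 649–677, p.664 (pairing convention), Lemma 4.5 (4.38) p.674 (A = 0 model)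
(bib key `King1986`).
-/

noncomputable section
open scoped BigOperators

namespace Summit.QuantumFields.YangMills.BalabanUVNodes.N15.KingModel

open Literature.MathematicalPhysics.QuantumFieldTheory.Balaban1983to89 hiding blockOf
open Literature.MathematicalPhysics.QuantumFieldTheory.Balaban1983to89.T4EtaRate (PairedInstance EtaPairing NE2PlusUnit EtaRateIneqUnit)
open Literature.MathematicalPhysics.QuantumFieldTheory.Balaban1983to89.B5Prop11Plancherel (Tor fine)
open Literature.MathematicalPhysics.QuantumFieldTheory.King1986.Torus (blockOf tdistT)

variable {d : ℕ} (L : ℕ) [NeZero L]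

/-! ## §1 The size-only sort and its dressed unit-layer family -/

/-- **THE POTENTIAL SORT, SIZE-ONLY READING**: configurations = potential towers over the unit torus (as part 8c's `potBg`); **(3.35) at `(c₃₅, α₀)` := size
`sup|v_N| ≤ c₃₅α₀`**; **(3.36) := VACUOUS** (`True`); complex-extension sorts inert.  HONEST SCOPE: scalar potentials, NOT gauge fields; the slot assignment is
OUR reading — this sort exists to state part 22's negative result by name. [cite: Balaban1985BackgroundPropagators, (3.35)–(3.36) p.396 (the two regularity slots: typing template)] -/
@[reducible] def potBgSize (U : Fin (d + 1) → ℕ) : B9.Backgrounds where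
  Cfg := ∀ N : ℕ, Tor (fine N U) → ℝ
  one := fun _ _ => 0
  mul := fun v v' N x => v N x + v' N x
  Reg335 := fun c35 α₀ v => ∀ (N : ℕ) (x : Tor (fine N U)), |v N x| ≤ c35 * α₀
  Reg336 := fun _ _ _ => True
  Cplx337 := fun _ _ _ => True
  Cplx338 := fun _ _ _ => True

/-- THE SORT IS POPULATED BY SITE-DEPENDENT TOWERS: the block lift of ANY unit-lattice field `W` with `sup|W| ≤ c₃₅α₀` is (3.35)-regular (and trivially
(3.36)-regular) in the size-only reading. [folklore] -/
theorem potBgSize_reg_blockLift (U : Fin (d + 1) → ℕ) [∀ μ, NeZero (U μ)] (W : Tor U → ℝ) {c35 α₀ : ℝ} (hW : ∀ z, |W z| ≤ c35 * α₀) :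
    (potBgSize (d := d) U).Reg335 c35 α₀ (blockLift U W) ∧ (potBgSize (d := d) U).Reg336 c35 α₀ (blockLift U W) := by
  refine ⟨fun N x => ?_, trivial⟩
  show |blockLift U W N x| ≤ c35 * α₀
  by_cases h : N = 0
  · simp only [blockLift, dif_pos h, abs_zero]
    exact (abs_nonneg _).trans (hW fun _ => 0)
  · haveI : NeZero N := ⟨h⟩
    rw [blockLift_apply]
    exact hW _

/-- THE η-PAIRING for the size-only sort (identity transport, scale shift `n`; as part 8c's `kingPairingV`). [cite: King1986, p.664 (convention before Prop. 3.8)] -/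
def kingPairingSize (i : KingPotIdx d) :
    EtaPairing (kingGeoCV L i) (kingGeoFV L i) (potBgSize (kingU d L i.e)) (potBgSize (kingU d L i.e)) where
  n := i.n
  k_eq := rfl
  L_eq := rfl
  M_eq := rfl
  eta_eq := by
    have hL0 : (L : ℝ) ≠ 0 := Nat.cast_ne_zero.mpr (NeZero.ne L)
    show (((L : ℝ) ^ (i.k + i.n)))⁻¹ * (L : ℝ) ^ i.n = (((L : ℝ) ^ i.k))⁻¹
    rw [pow_add, mul_inv, mul_assoc, inv_mul_cancel₀ (pow_ne_zero _ hL0), mul_one]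
  ι := fun y => y
  scale_ι := fun _ => rfl
  dist_ι := fun _ _ => rfl
  τ := fun lam => lam
  suppIn_τ := fun _ _ h => h
  supNorm_τ := fun _ => le_rfl
  avg := fun v => v
  avg_one := rfl

/-- THE DRESSED KING FAMILY WITH THE SIZE-ONLY SORT LIVE (same geometries as `kingInstanceV`). [cite: Balaban1985BackgroundPropagators, Thm 3.15 p.432 (typing template)] -/
def kingInstanceSize (i : KingPotIdx d) : PairedInstance :=
  ⟨kingGeoCV L i, kingGeoFV L i, potBgSize (kingU d L i.e), potBgSize (kingU d L i.e), kingPairingSize L i⟩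

/-- The dressed unit kernel on the size-only family: part 10d's `kingKerVW` (the one-step η-difference `C^{(k+1)}_v − C^{(k)}_v` of the covariances of the
FULLY dressed King tower), verbatim. [cite: King1986, Lemma 4.5 (4.38) p.674 (object, A = 0)] -/
def kingKerSize (a m2 : ℝ) (i : KingPotIdx d) : B9.SiteKernel (kingInstanceSize L i).gc (kingInstanceSize L i).Bf :=
  ⟨(kingKerVW L a m2 0 i).ker⟩

/-- `unitDist :=` King's periodic unit-lattice distance. [cite: King1986, Lemma 4.5 (4.38) p.674] -/
def kingDistSize : ∀ i : KingPotIdx d, (kingInstanceSize L i).gc.Site → (kingInstanceSize L i).gc.Site → ℝ :=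
  fun i y y' => tdistT (kingU d L i.e) y y'

/-! ## §2 `NE2PlusUnit` fails on the size-only sort, by name -/

/-- **`NE2PlusUnit` FAILS BY NAME FOR THE DRESSED COVARIANCES ON THE SIZE-ONLY SORT** (`L ≥ 2`, `a, m² > 0`, every `c₃₅ > 0`):
`¬ NE2PlusUnit c₃₅ (kingInstanceSize L) (kingKerSize L a m²) ⊤ tdistT` — part 22's `ne2PlusUnit_false_without_coherence` (the (3.36) hypothesis of the
predicate is `True` here, so the predicate IS the `Reg336`-free definiens).  CONTRAST: with the coherence slot live the predicate HOLDS (part 10d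
`ne2PlusUnit_kingVW`, part 15 `ne2PlusUnit_kingSC`).  HONEST SCOPE: module docstring.
[cite: Balaban1985BackgroundPropagators, (3.35)–(3.36) p.396 + Thm 3.15 (3.187) p.432 (quantifier template); King1986, Lemma 4.5 (4.38) p.674 (A = 0 model)] -/
theorem not_ne2PlusUnit_kingSize (hL : 2 ≤ L) {a m2 : ℝ} (ha : 0 < a) (hm : 0 < m2) {c35 : ℝ} (hc : 0 < c35) :
    ¬ NE2PlusUnit c35 (kingInstanceSize (d := d) L) (kingKerSize L a m2) (fun _ _ => True) (kingDistSize L) := by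
  rintro ⟨δ₀, a₀, B₀, θ, hδ, ha₀, hB, hθ0, hθ1, H⟩
  refine ne2PlusUnit_false_without_coherence (d := d) L hL ha hm hc 0 ⟨δ₀, a₀, B₀, θ, hδ, ha₀, hB, hθ0, hθ1, ?_⟩
  intro i α₀ hα hMa v h335 y y' hy hy'
  exact H i α₀ hα hMa v h335 trivial y y' hy hy'

end Summit.QuantumFields.YangMills.BalabanUVNodes.N15.KingModel

end
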